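import Literature.MathematicalPhysics.StatisticalMechanics.NJLChiralSymmetryBreaking
import Literature.MathematicalPhysics.StatisticalMechanics.ComplexSpinFluctuationVanishing
import HarnessLib

/-!
# Salmhofer–Seiler's Corollary 4.4 (2): mean-field exactness as `N → ∞` or `ν → ∞`, and the
# explicit lower bound (4.17) on the chiral order parameter (CMP 139 (1991), p. 419)

A short file of the Salmhofer–Seiler series; theorems only.  Corollary 4.4 (p. 419): "(2) Mean
field theory, which neglects all fluctuations, is an upper bound for the expectation value of
`⟨ψ̄ψ⟩`.  The lower bound is of precisely the same form, except that in it the effect of the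
fluctuations has been included and bounded by `2S(ν)/N`.  Therefore, as `N → ∞` or `ν → ∞`, the
fluctuations die out, the lower bound `s₂` approaches the upper one `s₁` and the mean-field solution
indeed becomes exact in either of these limits.  An explicit lower bound for `X` for `ν ≥ ν₀`
(`ν₀` specified in the appendix), is `X ≥ (2N/√(2ν))(1 - 2c(ν₀)/(Nν^{1/4}))^{1/2}`. (4.17)"

The tree has Cor. 4.4 (1) (4.16) as `njl_chiralOrderParameter_bounds` /
`njl_chiralOrderParameter_pos` (in the normalisation `σ = ψ̄ψ/2N`:
`s₁ = 1/√(2ν) ≥ X/2N ≥ s₂ = (1/√(2ν))(1 - 2S(ν)/N)^{1/2}`) and Prop. 4.2 (3) with the explicit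
rate `S(ν) ≤ 2/(ν-2) + 1/√(2ν)` (`fluctS_le_rate`).  This file records Cor. 4.4 (2):

* `tendsto_meanFieldFactor_colours`, `tendsto_meanFieldFactor_dim` — the ratio
  `s₂/s₁ = (1 - 2S(ν)/N)^{1/2}` tends to `1` as `N → ∞` (every `ν`) and as `ν → ∞` (every `N`):
  "the mean-field solution indeed becomes exact in either of these limits";
* `fluctS_le_seven_div_rpow` — `S(ν) ≤ 7 ν^{-1/4}` for all `ν ≥ 3` (from the tree's rate; the print
  leaves the constant `c(ν₀)` of (4.17) to Lemma A.7 of the appendix without a closed value — the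
  tree's Prop. 4.2 (3) gives `c = 7`, `ν₀ = 3`);
* **`njl_chiralOrderParameter_ge_explicit`** — (4.17) with `c(ν₀) = 7`, `ν₀ = 3`:
  `X/2N = liminf_{m→0+} s(m) ≥ (1/√(2ν))(1 - 14/(N ν^{1/4}))^{1/2}` whenever `2S(ν)/N < 1` is
  guaranteed (`ν ≥ 4`, or `ν ≥ 3` and `N ≥ 2`), for the thermodynamic limit `s(m)` of the condensate
  along even tori (Cor. 3.9).

Faithfulness / scope: `β = 0` NJL system / strongly coupled QED, real mass, limits along even
tori as in `NJLChiralCondensateLowerBound`; (4.17) is reproduced with an explicit admissible constant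
in place of the unspecified printed one (any `c(ν₀)` with `S(ν) ≤ c ν^{-1/4}` for `ν ≥ ν₀` serves in
the printed argument).  Nothing about `β > 0`, the continuum, a mass gap or the summit's `QCD`
conjunct.

## References

* M. Salmhofer, E. Seiler, *Proof of chiral symmetry breaking in strongly coupled lattice gauge
  theory*, Commun. Math. Phys. 139 (1991) 395–432: Cor. 4.4 (2), (4.16)–(4.17) p. 419;
  Prop. 4.2 (3) p. 417. [SalmhoferSeiler1991]
-/

noncomputable section

open MvPolynomial Finset Filter Topology
open Literature.Probability.LatticeModels (TorusSite Site)
open Literature.Probability.LatticeModels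

namespace Literature.MathematicalPhysics.StatisticalMechanics

namespace ComplexSpin

variable {ν N : ℕ}

/-! ### The fluctuation factor `(1 - 2S(ν)/N)^{1/2} = s₂/s₁` tends to one -/

/-- **Cor. 4.4 (2), `N → ∞`**: for every dimension `ν`, the ratio `s₂/s₁ = (1 - 2S(ν)/N)^{1/2}` of the
lower (4.8) to the upper (4.6) mean-field bound on the condensate tends to `1` as the number of
colours `N → ∞` — "as `N → ∞` … the fluctuations die out, the lower bound `s₂` approaches the upper
one `s₁`". [cite: SalmhoferSeiler1991, Cor. 4.4 (2)] -/
theorem tendsto_meanFieldFactor_colours (ν : ℕ) :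
    Tendsto (fun N : ℕ => Real.sqrt (1 - 2 * fluctS ν / N)) atTop (𝓝 1) := by
  have h1 : Tendsto (fun N : ℕ => 2 * fluctS ν / (N : ℝ)) atTop (𝓝 0) :=
    tendsto_const_nhds.div_atTop tendsto_natCast_atTop_atTop
  have h2 : Tendsto (fun N : ℕ => 1 - 2 * fluctS ν / (N : ℝ)) atTop (𝓝 (1 - 0)) :=
    tendsto_const_nhds.sub h1
  rw [sub_zero] at h2
  have h3 := (Real.continuous_sqrt.tendsto 1).comp h2
  rwa [Function.comp_def, Real.sqrt_one] at h3

/-- **Cor. 4.4 (2), `ν → ∞`**: for every number of colours `N`, the ratio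
`s₂/s₁ = (1 - 2S(ν)/N)^{1/2}` tends to `1` as the dimension `ν → ∞`, because `S(ν) → 0`
(Prop. 4.2 (3)) — "… or `ν → ∞`, the fluctuations die out … the mean-field solution indeed becomes
exact in either of these limits". [cite: SalmhoferSeiler1991, Cor. 4.4 (2) and Prop. 4.2 (3)] -/
theorem tendsto_meanFieldFactor_dim (N : ℕ) :
    Tendsto (fun ν : ℕ => Real.sqrt (1 - 2 * fluctS ν / N)) atTop (𝓝 1) := by
  have h1 : Tendsto (fun ν : ℕ => 2 * fluctS ν / (N : ℝ)) atTop (𝓝 (2 * 0 / N)) :=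
    (tendsto_fluctS.const_mul 2).div_const _
  rw [mul_zero, zero_div] at h1
  have h2 : Tendsto (fun ν : ℕ => 1 - 2 * fluctS ν / (N : ℝ)) atTop (𝓝 (1 - 0)) :=
    tendsto_const_nhds.sub h1
  rw [sub_zero] at h2
  have h3 := (Real.continuous_sqrt.tendsto 1).comp h2
  rwa [Function.comp_def, Real.sqrt_one] at h3

/-! ### The explicit constant in (4.17) -/

/-- `ν^{1/4} ≥ 1`, `ν^{1/4} ≤ ν` and `ν^{1/4} ≤ √(2ν)` for `ν ≥ 1`. [folklore] -/
private theorem rpow_quarter_bounds (hν : 1 ≤ ν) :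
    1 ≤ (ν : ℝ) ^ (1 / 4 : ℝ) ∧ (ν : ℝ) ^ (1 / 4 : ℝ) ≤ ν ∧
      (ν : ℝ) ^ (1 / 4 : ℝ) ≤ Real.sqrt (2 * ν) := by
  have hν1 : (1 : ℝ) ≤ ν := by exact_mod_cast hν
  refine ⟨Real.one_le_rpow hν1 (by norm_num), ?_, ?_⟩
  · calc (ν : ℝ) ^ (1 / 4 : ℝ) ≤ (ν : ℝ) ^ (1 : ℝ) :=
          Real.rpow_le_rpow_of_exponent_le hν1 (by norm_num)
      _ = ν := Real.rpow_one _
  · calc (ν : ℝ) ^ (1 / 4 : ℝ) ≤ (ν : ℝ) ^ (1 / 2 : ℝ) :=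
          Real.rpow_le_rpow_of_exponent_le hν1 (by norm_num)
      _ = Real.sqrt ν := (Real.sqrt_eq_rpow _).symm
      _ ≤ Real.sqrt (2 * ν) := Real.sqrt_le_sqrt (by linarith)

/-- **`S(ν) ≤ 7 ν^{-1/4}` for all `ν ≥ 3`** — an admissible explicit constant for (4.17), from the
tree's rate `S(ν) ≤ 2/(ν-2) + 1/√(2ν)` (Prop. 4.2 (3)): `2/(ν-2) ≤ 6/ν ≤ 6 ν^{-1/4}` and
`1/√(2ν) ≤ ν^{-1/4}`. [cite: SalmhoferSeiler1991, Prop. 4.2 (3) and Cor. 4.4 (2) (4.17)] -/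
theorem fluctS_le_seven_div_rpow (hν : 3 ≤ ν) :
    fluctS ν ≤ 7 / (ν : ℝ) ^ (1 / 4 : ℝ) := by
  obtain ⟨ht1, htν, htsq⟩ := rpow_quarter_bounds (ν := ν) (by omega)
  set t := (ν : ℝ) ^ (1 / 4 : ℝ) with ht
  have ht0 : 0 < t := by linarith
  have hν3 : (3 : ℝ) ≤ ν := by exact_mod_cast hν
  have h1 : 2 / ((ν : ℝ) - 2) ≤ 6 / t := by
    calc 2 / ((ν : ℝ) - 2) ≤ 6 / ν := by
          rw [div_le_div_iff₀ (by linarith) (by linarith)]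
          linarith
      _ ≤ 6 / t := div_le_div_of_nonneg_left (by norm_num) ht0 htν
  have h2 : 1 / Real.sqrt (2 * ν) ≤ 1 / t := div_le_div_of_nonneg_left (by norm_num) ht0 htsq
  calc fluctS ν ≤ 2 / ((ν : ℝ) - 2) + 1 / Real.sqrt (2 * ν) := fluctS_le_rate hν
    _ ≤ 6 / t + 1 / t := add_le_add h1 h2
    _ = 7 / t := by ring

/-- `2S(ν)/N ≤ 14/(N ν^{1/4})` (`ν ≥ 3`, `N ≥ 1`). [cite: SalmhoferSeiler1991, Cor. 4.4 (2) (4.17)] -/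
theorem two_mul_fluctS_div_le_explicit (hν : 3 ≤ ν) (hN : 1 ≤ N) :
    2 * fluctS ν / N ≤ 14 / (N * (ν : ℝ) ^ (1 / 4 : ℝ)) := by
  obtain ⟨ht1, -, -⟩ := rpow_quarter_bounds (ν := ν) (by omega)
  have ht0 : 0 < (ν : ℝ) ^ (1 / 4 : ℝ) := by linarith
  have hN0 : (0 : ℝ) < N := by exact_mod_cast hN
  have h := fluctS_le_seven_div_rpow hν
  rw [div_le_div_iff₀ hN0 (by positivity)]
  have h2 : fluctS ν * (ν : ℝ) ^ (1 / 4 : ℝ) ≤ 7 := by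
    rwa [le_div_iff₀ ht0] at h
  nlinarith

/-- **(4.17) with an explicit constant: Cor. 4.4 (2), the lower bound on the chiral order
parameter for `ν ≥ ν₀ = 3`.**  For the NJL system (`N` colours; strongly coupled QED is `N = 1`)
in dimension `ν ≥ 4`, or `ν ≥ 3` with `N ≥ 2`, the thermodynamic limit `s(m)` of the condensate
`⟨σ_x⟩_Λ(m)` along even tori satisfies
`X/2N = liminf_{m→0+} s(m) ≥ (1/√(2ν)) (1 - 14/(N ν^{1/4}))^{1/2}` — the printed
`X ≥ (2N/√(2ν))(1 - 2c(ν₀)/(Nν^{1/4}))^{1/2}` with `c(ν₀) = 7` (the print leaves `c(ν₀)` to the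
appendix). [cite: SalmhoferSeiler1991, Cor. 4.4 (2) (4.17)] -/
theorem njl_chiralOrderParameter_ge_explicit (hν : 3 ≤ ν) (hN : 1 ≤ N) (h : 4 ≤ ν ∨ 2 ≤ N)
    {s : ℝ → ℝ}
    (hs : ∀ m : ℝ, 0 < m → ∃ (Ls : ℕ → ℕ) (_ : ∀ j, NeZero (Ls j)),
      (∀ j, Even (Ls j)) ∧ Tendsto Ls atTop atTop ∧
        Tendsto (fun j => expect (ν := ν) (L := Ls j) N m (njlBondCoeff N) (X 0)) atTop
          (𝓝 (s m))) :
    1 / Real.sqrt (2 * ν) * Real.sqrt (1 - 14 / (N * (ν : ℝ) ^ (1 / 4 : ℝ))) ≤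
      liminf s (𝓝[>] 0) := by
  refine le_trans ?_ (njl_chiralOrderParameter_pos hν hN h hs).1
  exact mul_le_mul_of_nonneg_left
    (Real.sqrt_le_sqrt (by linarith [two_mul_fluctS_div_le_explicit (ν := ν) hν hN]))
    (by positivity)

end ComplexSpin

end Literature.MathematicalPhysics.StatisticalMechanics
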